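import Literature.Combinatorics.Optimization.ShellLawWeightedEdgeProduct
import HarnessLib

/-!
# The weighted LEVEL STEP: one level step is a (mixed) second difference for multi-block shell statistics

Continuation of `ShellLawWeightedEdgeProduct.lean` (cell `pnp-psdrank`, lit g32).  For a perfect matching
(`π` its partner involution), a `π`-stable ground set `S` and ARBITRARY vertex weights `ω : Fin n → R` put
`W_S(t,c) := Σ_{U ∈ Shell_S(t,c)} Π_{v∈U} ω v`.  `ShellLawLevelStep.levelStep_shellCount` (lit g31, I32) is
the case `ω = X^{[·∈H]}` of the following identity, proved here for all weights:

  `2·[(c+2)(c+1)·W_S(t+2,c+2) − (t+2−c)(|S|−t−2−c)·W_S(t+2,c)]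
      = − Σ_{p∈S} Σ_{q∈S∖e_p} (ω p − ω q)(ω πp − ω πq) · W_{S∖e_p∖e_q}(t,c)`          (`wLevelStep_two_mul`)

(ordered pairs of vertices on different edges).  For ONE block the right-hand side is
`−2·(1−X)²·[4ad·W′ − b(b−1)·W″]`-type (I32); for TWO blocks `ω = X₁^{[·∈H₁]}X₂^{[·∈H₂]}` the factors
`(ω p − ω q)(ω πp − ω πq)` are `(1−X_i)²`, `(X₁−X₂)²`, `(1−X₁)(1−X₂)`, `(1−X_i)(X_j−X_i)`, … — the MIXED second
differences of LIT-44 §1.4(i) (eng g21's two-block class CG2SYM).  On paper the identity is the coefficient form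
of `(∂_Z² − 4∂_T∂_W)Ψ^ω = −Σ_{e≠e′}[(u−u′)(v−v′)+(u−v′)(v−u′)]Ψ^ω_{−e−e′}` for the homogenised weighted edge product;
the proof below avoids calculus: three first-order PINNING identities (a half-matched vertex, a full edge, an
untouched edge — weighted versions of `ShellLawLevelStep` §7 / `ShellLawEdgeProduct` §7) and a symmetrisation.

* §1 `shellIn_filter_avoid_eq`, `sum_shellIn_half_eq` — pin bijections in sum form (with
  `ShellLawEdgeProduct.sum_shellIn_full_eq`).
* §2 **`wPin_half`** (`(c+1)·W_S(t+1,c+1) = Σ_p ω p·W_{S∖e_p}(t,c)`), **`wPin_full`**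
  (`(t+2−c)·W_S(t+2,c) = Σ_p ω p ω πp·W_{S∖e_p}(t,c)`), **`wPin_free`** (`(|S|−t−c)·W_S(t,c) = Σ_p W_{S∖e_p}(t,c)`).
* §3 reindexing (`del2` under `p ↦ πp`, `q ↦ πq`, `(p,q) ↦ (q,p)`) and **`wLevelStep_two_mul`**.
* §4 the two-pin identities as named theorems: **`wPin_half_half`** (`(c+2)(c+1)·W_S(t+2,c+2) =
  ΣΣ ω p ω q·W_{S∖e_p∖e_q}(t,c)`), **`wPin_full_free`** (`(t+2−c)(|S|−t−2−c)·W_S(t+2,c) = ΣΣ ω p ω πp·W″`),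
  **`wPin_half_full`** (`(c+1)(t+2−c)·W_S(t+3,c+1) = ΣΣ ω p·ω q ω πq·W″`), **`wPin_full_full`**
  (`(t+4−c)(t+2−c)·W_S(t+4,c) = ΣΣ ω p ω πp·ω q ω πq·W″`) — all sums over ordered pairs `p ∈ S`, `q ∈ S ∖ e_p`.
* §5 ITERATION (weighted twin of `ShellLawLevelStep.liter_prof_eq`): the operators `wlstep` / `wliter` on `R`-valued
  level profiles, the weighted shell-sum profile `wsum` and the `m`-fold weighted deletion profile `wdelIter`
  (`D^ω_{m+1}(S) = Σ_{p∈S}Σ_{q∈S∖e_p} (ω p − ω q)(ω πp − ω πq)·D^ω_m(S∖e_p∖e_q)`), their linearity, `wlstep_wsum`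
  (one step in profile form) and **`wliter_wsum_eq`**:
  `2^m · (L_{t+2,|S|−4(m−1)} ∘ ⋯ ∘ L_{t+2m,|S|}) [c ↦ W_S(t+2m,c)] = (−1)^m · D^ω_m(S)(t,·)`.

Everything is proved; the only definitions are the four bookkeeping operators of §5; no named facts.  (Companion: `ShellLawColouredEdgeProduct.lean`, eng g21,
holds the colour-class bookkeeping for DISJOINT blocks — nine-pair product, class-count transport; its §1–§2
`colourGF_eq_prod` / `edgeFactor_exchange` are the same identities as `ShellLawWeightedEdgeProduct`'s
`wShellGF_eq_prod` / `edgeFactor_swap`, typed concurrently.)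

## References

* [Rothvoss2017] T. Rothvoß, *The matching polytope has exponential extension complexity*, J. ACM 64
  (2017), §2 (PDF pp. 5–6).
* [GodsilMeagher2015] C. Godsil, K. Meagher, *Erdős–Ko–Rado Theorems: Algebraic Approaches*, CUP 2015, §15.2.
-/

noncomputable section

open Finset

namespace Literature.Combinatorics.Optimization

namespace ShellStep

variable {n : ℕ} {π : Fin n → Fin n} {R : Type*} [CommRing R]

section WeightedLevel

variable (hπ : ∀ v, π (π v) = v) (hπ' : ∀ v, π v ≠ v)
include hπ hπ'

/-! ### §1 Pin bijections in sum form -/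

omit hπ hπ' in
/-- Cuts avoiding the edge at `v` are the cuts of `S ∖ e_v`. [cite: Rothvoss2017, §2 (PDF p. 6)] -/
theorem shellIn_filter_avoid_eq (S : Finset (Fin n)) (v : Fin n) (t c : ℕ) :
    (shellIn π S t c).filter (fun U => v ∉ U ∧ π v ∉ U) = shellIn π (S \ {v, π v}) t c := by
  ext U
  simp only [mem_filter, mem_shellIn, subset_sdiff, disjoint_insert_right, disjoint_singleton_right]
  tauto

/-- **Pinning one half-matched vertex is deleting its edge** (sum form):
`Σ_{U ∈ Shell_S(t+1,c+1), v ∈ U, πv ∉ U} g(U) = Σ_{W ∈ Shell_{S∖e_v}(t,c)} g(W + v)`.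
[cite: Rothvoss2017, §2 (PDF p. 6)] -/
theorem sum_shellIn_half_eq {M : Type*} [AddCommMonoid M] {S : Finset (Fin n)} {v : Fin n} (hv : v ∈ S)
    (t c : ℕ) (g : Finset (Fin n) → M) :
    ∑ U ∈ (shellIn π S (t + 1) (c + 1)).filter (fun U => v ∈ U ∧ π v ∉ U), g U =
      ∑ W ∈ shellIn π (S \ {v, π v}) t c, g (insert v W) := by
  have hvπ : v ≠ π v := fun h => hπ' v h.symm
  have hW : ∀ {W : Finset (Fin n)}, W ⊆ S \ {v, π v} → v ∉ W ∧ π v ∉ W := by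
    intro W hWS
    exact ⟨fun h => by have := mem_sdiff.1 (hWS h); simp at this,
      fun h => by have := mem_sdiff.1 (hWS h); simp at this⟩
  refine sum_nbij' (fun U => U.erase v) (fun W => insert v W) ?_ ?_ ?_ ?_ ?_
  · intro U hU
    simp only [mem_filter, mem_shellIn] at hU ⊢
    obtain ⟨⟨hUS, hUt, hUc⟩, hvU, hπvU⟩ := hU
    have h1 : v ∉ U.erase v := fun h => (mem_erase.1 h).1 rfl
    have h2 : π v ∉ U.erase v := fun h => hπvU (mem_erase.1 h).2
    have hU' : U = insert v (U.erase v) := (insert_erase hvU).symm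
    refine ⟨?_, ?_, ?_⟩
    · intro u hu
      rw [mem_sdiff, mem_insert, mem_singleton, not_or]
      obtain ⟨huv, huU⟩ := mem_erase.1 hu
      exact ⟨hUS huU, huv, fun h => hπvU (h ▸ huU)⟩
    · rw [card_erase_of_mem hvU, hUt]; rfl
    · have : half π U = insert v (half π (U.erase v)) := by
        conv_lhs => rw [hU']
        exact half_insert_of_notMem hπ hπ' h1 h2
      rw [this, card_insert_of_notMem (fun h => h1 (mem_half.1 h).1)] at hUc
      omega
  · intro W hW'
    simp only [mem_filter, mem_shellIn] at hW' ⊢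
    obtain ⟨hWS, hWt, hWc⟩ := hW'
    obtain ⟨hvW, hπvW⟩ := hW hWS
    refine ⟨⟨?_, ?_, ?_⟩, mem_insert_self _ _, ?_⟩
    · intro u hu
      rcases mem_insert.1 hu with rfl | hu
      · exact hv
      · exact (mem_sdiff.1 (hWS hu)).1
    · rw [card_insert_of_notMem hvW, hWt]
    · rw [half_insert_of_notMem hπ hπ' hvW hπvW, card_insert_of_notMem (fun h => hvW (mem_half.1 h).1), hWc]
    · rw [mem_insert, not_or]; exact ⟨fun h => hvπ h.symm, hπvW⟩
  · intro U hU
    simp only [mem_filter] at hU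
    exact insert_erase hU.2.1
  · intro W hW'
    simp only [mem_shellIn] at hW'
    exact erase_insert (hW hW'.1).1
  · intro U hU
    simp only [mem_filter] at hU
    show g U = g (insert v (U.erase v))
    rw [insert_erase hU.2.1]

/-- **Pinning one full edge is deleting it** (sum form, any additive codomain; the `ℝ`-valued case is
`ShellLawEdgeProduct.sum_shellIn_full_eq`). [cite: Rothvoss2017, §2 (PDF p. 6)] -/
theorem sum_shellIn_full_eq' {M : Type*} [AddCommMonoid M] {S : Finset (Fin n)} (hS : ∀ v ∈ S, π v ∈ S)
    {v : Fin n} (hv : v ∈ S) (t c : ℕ) (g : Finset (Fin n) → M) :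
    ∑ U ∈ (shellIn π S (t + 2) c).filter (fun U => v ∈ U ∧ π v ∈ U), g U =
      ∑ W ∈ shellIn π (S \ {v, π v}) t c, g (W ∪ {v, π v}) := by
  have hPcard : ({v, π v} : Finset (Fin n)).card = 2 := card_pair (hπ' v).symm
  have hPsub : ∀ {U : Finset (Fin n)}, v ∈ U → π v ∈ U → ({v, π v} : Finset (Fin n)) ⊆ U :=
    fun hvU hπvU u hu => by
      rcases mem_insert.1 hu with rfl | h
      · exact hvU
      · rw [mem_singleton] at h; subst h; exact hπvU
  have hW : ∀ {W : Finset (Fin n)}, W ⊆ S \ {v, π v} → v ∉ W ∧ π v ∉ W ∧ Disjoint W {v, π v} := by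
    intro W hWS
    have hvW : v ∉ W := fun h => by have := mem_sdiff.1 (hWS h); simp at this
    have hπvW : π v ∉ W := fun h => by have := mem_sdiff.1 (hWS h); simp at this
    exact ⟨hvW, hπvW, disjoint_left.2 fun u huW huP => by
      rcases mem_insert.1 huP with rfl | h
      · exact hvW huW
      · rw [mem_singleton] at h; subst h; exact hπvW huW⟩
  refine sum_nbij' (fun U => U \ {v, π v}) (fun W => W ∪ {v, π v}) ?_ ?_ ?_ ?_ ?_
  · intro U hU
    simp only [mem_filter, mem_shellIn] at hU ⊢
    obtain ⟨⟨hUS, hUt, hUc⟩, hvU, hπvU⟩ := hU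
    refine ⟨sdiff_subset_sdiff hUS le_rfl, ?_, ?_⟩
    · rw [card_sdiff_of_subset (hPsub hvU hπvU), hUt, hPcard]; rfl
    · rw [half_sdiff_pair hπ hvU hπvU, hUc]
  · intro W hW'
    simp only [mem_filter, mem_shellIn] at hW' ⊢
    obtain ⟨hWS, hWt, hWc⟩ := hW'
    obtain ⟨_, _, hdisj⟩ := hW hWS
    have hvU : v ∈ W ∪ {v, π v} := mem_union_right _ (mem_insert_self _ _)
    have hπvU : π v ∈ W ∪ {v, π v} :=
      mem_union_right _ (mem_insert_of_mem (mem_singleton_self _))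
    refine ⟨⟨?_, ?_, ?_⟩, hvU, hπvU⟩
    · intro u hu
      rcases mem_union.1 hu with h | h
      · exact (mem_sdiff.1 (hWS h)).1
      · rcases mem_insert.1 h with rfl | h
        · exact hv
        · rw [mem_singleton] at h; subst h; exact hS _ hv
    · rw [card_union_of_disjoint hdisj, hWt, hPcard]
    · have e : (W ∪ {v, π v}) \ {v, π v} = W := by
        rw [union_sdiff_right, sdiff_eq_self_of_disjoint hdisj]
      rw [← half_sdiff_pair hπ hvU hπvU, e, hWc]
  · intro U hU
    simp only [mem_filter] at hU
    exact sdiff_union_of_subset (hPsub hU.2.1 hU.2.2)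
  · intro W hW'
    simp only [mem_shellIn] at hW'
    obtain ⟨_, _, hdisj⟩ := hW hW'.1
    show (W ∪ {v, π v}) \ {v, π v} = W
    rw [union_sdiff_right, sdiff_eq_self_of_disjoint hdisj]
  · intro U hU
    simp only [mem_filter] at hU
    show g U = g (U \ {v, π v} ∪ {v, π v})
    rw [sdiff_union_of_subset (hPsub hU.2.1 hU.2.2)]

/-! ### §2 The three weighted pinning identities -/

omit hπ hπ' in
/-- The weight of `W + v`. [folklore] -/
private theorem prod_insert_weight (ω : Fin n → R) {W : Finset (Fin n)} {v : Fin n} (hv : v ∉ W) :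
    ∏ u ∈ insert v W, ω u = ω v * ∏ u ∈ W, ω u := prod_insert hv

/-- **Half-vertex pinning**: `(c+1)·W_S(t+1,c+1) = Σ_{p∈S} ω p · W_{S∖e_p}(t,c)` (choose which of the
`c+1` half-matched vertices is marked). [cite: Rothvoss2017, §2 (PDF p. 6)] -/
theorem wPin_half {S : Finset (Fin n)} (ω : Fin n → R) (t c : ℕ) :
    ((c : R) + 1) * ∑ U ∈ shellIn π S (t + 1) (c + 1), ∏ u ∈ U, ω u =
      ∑ p ∈ S, ω p * ∑ W ∈ shellIn π (S \ {p, π p}) t c, ∏ u ∈ W, ω u := by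
  -- right-hand side as a double sum over (U, p) with p ∈ half U
  have h1 : ∀ p ∈ S, ω p * ∑ W ∈ shellIn π (S \ {p, π p}) t c, ∏ u ∈ W, ω u =
      ∑ U ∈ shellIn π S (t + 1) (c + 1), if p ∈ U ∧ π p ∉ U then ∏ u ∈ U, ω u else 0 := by
    intro p hp
    rw [← sum_filter, sum_shellIn_half_eq hπ hπ' hp, mul_sum]
    refine sum_congr rfl fun W hW => ?_
    have hpW : p ∉ W := fun h => by have := mem_sdiff.1 ((mem_shellIn.1 hW).1 h); simp at this
    rw [prod_insert hpW]
  rw [sum_congr rfl h1, sum_comm]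
  rw [mul_sum]
  refine sum_congr rfl fun U hU => ?_
  rw [← sum_filter]
  have hUS : U ⊆ S := (mem_shellIn.1 hU).1
  have e : S.filter (fun p => p ∈ U ∧ π p ∉ U) = half π U := by
    ext p; rw [mem_filter, mem_half]; exact ⟨fun h => h.2, fun h => ⟨hUS h.1, h⟩⟩
  rw [e, sum_const, nsmul_eq_mul, (mem_shellIn.1 hU).2.2]
  push_cast; ring

/-- **Full-edge pinning**: `(t+2−c)·W_S(t+2,c) = Σ_{p∈S} ω p ω πp · W_{S∖e_p}(t,c)` (mark one of the
`t+2−c` fully matched vertices). [cite: Rothvoss2017, §2 (PDF p. 6)] -/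
theorem wPin_full {S : Finset (Fin n)} (hS : ∀ v ∈ S, π v ∈ S) (ω : Fin n → R) (t c : ℕ) :
    ((t : R) + 2 - c) * ∑ U ∈ shellIn π S (t + 2) c, ∏ u ∈ U, ω u =
      ∑ p ∈ S, ω p * ω (π p) * ∑ W ∈ shellIn π (S \ {p, π p}) t c, ∏ u ∈ W, ω u := by
  have h1 : ∀ p ∈ S, ω p * ω (π p) * ∑ W ∈ shellIn π (S \ {p, π p}) t c, ∏ u ∈ W, ω u =
      ∑ U ∈ shellIn π S (t + 2) c, if p ∈ U ∧ π p ∈ U then ∏ u ∈ U, ω u else 0 := by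
    intro p hp
    rw [← sum_filter, sum_shellIn_full_eq' hπ hπ' hS hp, mul_sum]
    refine sum_congr rfl fun W hW => ?_
    have hWS := (mem_shellIn.1 hW).1
    have hpW : p ∉ W := fun h => by have := mem_sdiff.1 (hWS h); simp at this
    have hπpW : π p ∉ W := fun h => by have := mem_sdiff.1 (hWS h); simp at this
    have hdisj : Disjoint W {p, π p} := disjoint_left.2 fun u huW huP => by
      rcases mem_insert.1 huP with rfl | h
      · exact hpW huW
      · rw [mem_singleton] at h; subst h; exact hπpW huW
    rw [prod_union hdisj, prod_pair (fun h => hπ' p h.symm)]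
    ring
  rw [sum_congr rfl h1, sum_comm, mul_sum]
  refine sum_congr rfl fun U hU => ?_
  rw [← sum_filter]
  have hUS : U ⊆ S := (mem_shellIn.1 hU).1
  have e : S.filter (fun p => p ∈ U ∧ π p ∈ U) = full π U := by
    ext p; rw [mem_filter, mem_full]; exact ⟨fun h => h.2, fun h => ⟨hUS h.1, h⟩⟩
  rw [e, sum_const, nsmul_eq_mul, card_full_of_mem_shellIn hU]
  have := le_of_mem_shellIn hU
  rw [Nat.cast_sub (by omega : c ≤ t + 2)]; push_cast; ring

omit hπ' in
/-- **Untouched-edge pinning**: `(|S|−t−c)·W_S(t,c) = Σ_{p∈S} W_{S∖e_p}(t,c)` (mark one of the `|S|−t−c`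
free vertices). [cite: Rothvoss2017, §2 (PDF p. 6)] -/
theorem wPin_free {S : Finset (Fin n)} (hS : ∀ v ∈ S, π v ∈ S) (ω : Fin n → R) (t c : ℕ) :
    ((S.card : R) - t - c) * ∑ U ∈ shellIn π S t c, ∏ u ∈ U, ω u =
      ∑ p ∈ S, ∑ W ∈ shellIn π (S \ {p, π p}) t c, ∏ u ∈ W, ω u := by
  have h1 : ∀ p ∈ S, ∑ W ∈ shellIn π (S \ {p, π p}) t c, ∏ u ∈ W, ω u =
      ∑ U ∈ shellIn π S t c, if p ∉ U ∧ π p ∉ U then ∏ u ∈ U, ω u else 0 := by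
    intro p _
    rw [← sum_filter, shellIn_filter_avoid_eq]
  rw [sum_congr rfl h1, sum_comm, mul_sum]
  refine sum_congr rfl fun U hU => ?_
  rw [← sum_filter]
  have e : S.filter (fun p => p ∉ U ∧ π p ∉ U) = freeIn π S U := by
    ext p; simp only [mem_filter, freeIn, mem_sdiff]; tauto
  rw [e, sum_const, nsmul_eq_mul, card_freeIn_of_mem_shellIn hπ hS hU]
  have := add_le_of_mem_shellIn hπ hS hU
  rw [Nat.sub_sub, Nat.cast_sub this]
  push_cast; ring

/-! ### §3 Symmetrisation and the weighted level step -/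

omit hπ' in
/-- `S ∖ e_{πp} = S ∖ e_p`. [cite: GodsilMeagher2015, §15.2] -/
theorem sdiff_pair_partner_eq (S : Finset (Fin n)) (p : Fin n) :
    S \ {π p, π (π p)} = S \ {p, π p} := by
  rw [hπ, pair_comm]

omit hπ' in
/-- `del2` is blind to which endpoint names the edge (left). [cite: GodsilMeagher2015, §15.2] -/
theorem del2_partner_left (S : Finset (Fin n)) (p q : Fin n) : del2 π S (π p) q = del2 π S p q := by
  ext u; simp only [mem_del2, hπ]; tauto

omit hπ' in
/-- `del2` is blind to which endpoint names the edge (right). [cite: GodsilMeagher2015, §15.2] -/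
theorem del2_partner_right (S : Finset (Fin n)) (p q : Fin n) : del2 π S p (π q) = del2 π S p q := by
  ext u; simp only [mem_del2, hπ]; tauto

omit hπ' in
/-- Reindexing the inner sum by the partner map. [cite: GodsilMeagher2015, §15.2] -/
theorem sum_sdiff_pair_partner {M : Type*} [AddCommMonoid M] {S : Finset (Fin n)} (hS : ∀ v ∈ S, π v ∈ S)
    (p : Fin n) (F : Fin n → M) :
    ∑ q ∈ S \ {p, π p}, F (π q) = ∑ q ∈ S \ {p, π p}, F q := by
  have hst := sdiff_pair_stable hπ hS p
  exact sum_nbij' (fun q => π q) (fun q => π q) (fun q hq => hst q hq) (fun q hq => hst q hq)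
    (fun q _ => hπ q) (fun q _ => hπ q) (fun _ _ => rfl)

omit hπ' in
/-- Reindexing the outer sum by the partner map. [cite: GodsilMeagher2015, §15.2] -/
theorem sum_partner {M : Type*} [AddCommMonoid M] {S : Finset (Fin n)} (hS : ∀ v ∈ S, π v ∈ S)
    (G : Fin n → M) : ∑ p ∈ S, G (π p) = ∑ p ∈ S, G p :=
  sum_nbij' (fun q => π q) (fun q => π q) (fun q hq => hS q hq) (fun q hq => hS q hq)
    (fun q _ => hπ q) (fun q _ => hπ q) (fun _ _ => rfl)

omit hπ' in
/-- Swapping the order of an off-edge double sum. [cite: GodsilMeagher2015, §15.2] -/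
theorem sum_sum_sdiff_pair_comm {M : Type*} [AddCommMonoid M] (S : Finset (Fin n)) (F : Fin n → Fin n → M) :
    ∑ p ∈ S, ∑ q ∈ S \ {p, π p}, F p q = ∑ q ∈ S, ∑ p ∈ S \ {q, π q}, F p q := by
  have e : ∀ (a : Fin n), S \ {a, π a} = S.filter (fun b => b ≠ a ∧ b ≠ π a) := by
    intro a; ext b; simp only [mem_sdiff, mem_insert, mem_singleton, not_or, mem_filter]
  simp_rw [e, sum_filter]
  rw [sum_comm]
  refine sum_congr rfl fun q _ => sum_congr rfl fun p _ => ?_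
  have : (q ≠ p ∧ q ≠ π p) ↔ (p ≠ q ∧ p ≠ π q) := by
    constructor
    · rintro ⟨h1, h2⟩; exact ⟨fun h => h1 h.symm, fun h => h2 (by rw [h, hπ])⟩
    · rintro ⟨h1, h2⟩; exact ⟨fun h => h1 h.symm, fun h => h2 (by rw [h, hπ])⟩
  exact if_congr this rfl rfl

/-- **The weighted LEVEL STEP.** For a `π`-stable ground set `S`, any vertex weights `ω` and all `t, c`:
`2·[(c+2)(c+1)·W_S(t+2,c+2) − (t+2−c)(|S|−t−2−c)·W_S(t+2,c)]
   = −Σ_{p∈S} Σ_{q∈S∖e_p} (ω p − ω q)(ω πp − ω πq)·W_{S∖e_p∖e_q}(t,c)`,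
`W_S(t,c) = Σ_{U∈Shell_S(t,c)} Π_{v∈U} ω v`.  One level step of a multi-block shell statistic is a (mixed)
SECOND DIFFERENCE of two-edge-deleted shell sums — no first-order term.
(Proof: half-pin twice gives `(c+2)(c+1)W = ΣΣ ωpωq·W_{pq}`, full-pin then free-pin gives
`(t+2−c)(|S|−t−2−c)W = ΣΣ ωpωπp·W_{pq}`; symmetrise the right-hand side under `q ↦ πq`, `p ↦ πp`, `p ↔ q`.)
[cite: Rothvoss2017, §2 (PDF p. 6)] -/
theorem wLevelStep_two_mul {S : Finset (Fin n)} (hS : ∀ v ∈ S, π v ∈ S) (ω : Fin n → R) (t c : ℕ) :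
    2 * (((c : R) + 2) * ((c : R) + 1) * ∑ U ∈ shellIn π S (t + 2) (c + 2), ∏ u ∈ U, ω u -
        ((t : R) + 2 - c) * ((S.card : R) - t - 2 - c) * ∑ U ∈ shellIn π S (t + 2) c, ∏ u ∈ U, ω u) =
      -∑ p ∈ S, ∑ q ∈ S \ {p, π p},
        (ω p - ω q) * (ω (π p) - ω (π q)) * ∑ U ∈ shellIn π (del2 π S p q) t c, ∏ u ∈ U, ω u := by
  -- (I) two half-pins
  have hI : ((c : R) + 2) * ((c : R) + 1) * ∑ U ∈ shellIn π S (t + 2) (c + 2), ∏ u ∈ U, ω u =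
      ∑ p ∈ S, ∑ q ∈ S \ {p, π p}, ω p * ω q * ∑ U ∈ shellIn π (del2 π S p q) t c, ∏ u ∈ U, ω u := by
    have h1 := wPin_half hπ hπ' (S := S) ω (t + 1) (c + 1)
    push_cast at h1
    rw [show ((c : R) + 2) * ((c : R) + 1) * ∑ U ∈ shellIn π S (t + 2) (c + 2), ∏ u ∈ U, ω u =
        ((c : R) + 1) * (((c : R) + 1 + 1) * ∑ U ∈ shellIn π S (t + 1 + 1) (c + 1 + 1), ∏ u ∈ U, ω u) by ring,
      h1, mul_sum]
    refine sum_congr rfl fun p hp => ?_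
    rw [← mul_assoc, mul_comm ((c : R) + 1) (ω p), mul_assoc,
      wPin_half hπ hπ' (S := S \ {p, π p}) ω t c, mul_sum]
    refine sum_congr rfl fun q _ => ?_
    rw [← del2_eq_sdiff_sdiff]; ring
  -- (II) full-pin then free-pin
  have hII : ((t : R) + 2 - c) * ((S.card : R) - t - 2 - c) * ∑ U ∈ shellIn π S (t + 2) c, ∏ u ∈ U, ω u =
      ∑ p ∈ S, ∑ q ∈ S \ {p, π p}, ω p * ω (π p) * ∑ U ∈ shellIn π (del2 π S p q) t c, ∏ u ∈ U, ω u := by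
    rw [show ((t : R) + 2 - c) * ((S.card : R) - t - 2 - c) * ∑ U ∈ shellIn π S (t + 2) c, ∏ u ∈ U, ω u =
        ((S.card : R) - t - 2 - c) * (((t : R) + 2 - c) * ∑ U ∈ shellIn π S (t + 2) c, ∏ u ∈ U, ω u) by ring,
      wPin_full hπ hπ' hS ω t c, mul_sum]
    refine sum_congr rfl fun p hp => ?_
    have hcard : ((S \ {p, π p}).card : R) = (S.card : R) - 2 := by
      have := card_sdiff_pair hπ' hS hp
      rw [← this]; push_cast; ring
    have h3 := wPin_free hπ (sdiff_pair_stable hπ hS p) ω t c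
    rw [hcard] at h3
    rw [← mul_assoc, mul_comm ((S.card : R) - t - 2 - c), mul_assoc,
      show (S.card : R) - t - 2 - c = (S.card : R) - 2 - t - c by ring, h3, mul_sum]
    refine sum_congr rfl fun q _ => ?_
    rw [← del2_eq_sdiff_sdiff]
  -- (III) symmetrisation of the right-hand side
  set V : Fin n → Fin n → R := fun p q => ∑ U ∈ shellIn π (del2 π S p q) t c, ∏ u ∈ U, ω u with hV
  have Vl : ∀ p q, V (π p) q = V p q := fun p q => by simp only [hV, del2_partner_left hπ]
  have Vr : ∀ p q, V p (π q) = V p q := fun p q => by simp only [hV, del2_partner_right hπ]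
  have Vc : ∀ p q, V q p = V p q := fun p q => by simp only [hV, del2_comm]
  have sA : ∑ p ∈ S, ∑ q ∈ S \ {p, π p}, ω q * ω (π q) * V p q =
      ∑ p ∈ S, ∑ q ∈ S \ {p, π p}, ω p * ω (π p) * V p q := by
    rw [sum_sum_sdiff_pair_comm hπ S (fun p q => ω q * ω (π q) * V p q)]
    refine sum_congr rfl fun q _ => sum_congr rfl fun p _ => ?_
    rw [Vc]
  have sB : ∑ p ∈ S, ∑ q ∈ S \ {p, π p}, ω p * ω (π q) * V p q =
      ∑ p ∈ S, ∑ q ∈ S \ {p, π p}, ω p * ω q * V p q := by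
    refine sum_congr rfl fun p _ => ?_
    rw [← sum_sdiff_pair_partner hπ hS p (fun q => ω p * ω q * V p q)]
    refine sum_congr rfl fun q _ => ?_
    rw [Vr]
  have sC : ∑ p ∈ S, ∑ q ∈ S \ {p, π p}, ω q * ω (π p) * V p q =
      ∑ p ∈ S, ∑ q ∈ S \ {p, π p}, ω p * ω q * V p q := by
    rw [← sum_partner hπ hS (fun p => ∑ q ∈ S \ {p, π p}, ω p * ω q * V p q)]
    refine sum_congr rfl fun p _ => ?_
    rw [sdiff_pair_partner_eq hπ]
    refine sum_congr rfl fun q _ => ?_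
    rw [Vl]; ring
  have expand : ∑ p ∈ S, ∑ q ∈ S \ {p, π p}, (ω p - ω q) * (ω (π p) - ω (π q)) * V p q =
      ∑ p ∈ S, ∑ q ∈ S \ {p, π p}, ω p * ω (π p) * V p q -
        ∑ p ∈ S, ∑ q ∈ S \ {p, π p}, ω p * ω (π q) * V p q -
        ∑ p ∈ S, ∑ q ∈ S \ {p, π p}, ω q * ω (π p) * V p q +
        ∑ p ∈ S, ∑ q ∈ S \ {p, π p}, ω q * ω (π q) * V p q := by
    rw [← sum_sub_distrib, ← sum_sub_distrib, ← sum_add_distrib]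
    refine sum_congr rfl fun p _ => ?_
    rw [← sum_sub_distrib, ← sum_sub_distrib, ← sum_add_distrib]
    refine sum_congr rfl fun q _ => ?_
    ring
  rw [hI, hII, expand, sA, sB, sC]
  ring

/-! ### §4 The three two-pin identities as named theorems

Steps (I) and (II) inside `wLevelStep_two_mul`, and the mixed composition, exported for consumers
(the cell's multi-block class CG2SYM; the `ψ`/count forms for ONE block — e.g. the
`|half U ∩ H|·(|half U ∩ H| − 1)` term of prover g22's crossing-plane decomposition — are derived in
`ShellLawHalfPinning.lean` from `sum_shellIn_half_eq` and are not repeated here).  The companion file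
`ShellLawColouredEdgeProduct.lean` (eng g21) holds the disjoint-block colour-class bookkeeping (nine-pair
product, class-count transport); the generic weighted pinning / level-step calculus lives here. -/

/-- **Two half-matched vertices pinned**: `(c+2)(c+1)·W_S(t+2,c+2) = Σ_{p∈S} Σ_{q∈S∖e_p} ω p·ω q·W_{S∖e_p∖e_q}(t,c)`
(mark an ordered pair of half-matched vertices; they lie on different edges; `half ∘ half`).
[cite: Rothvoss2017, §2 (PDF p. 6)] -/
theorem wPin_half_half {S : Finset (Fin n)} (ω : Fin n → R) (t c : ℕ) :
    ((c : R) + 2) * ((c : R) + 1) * ∑ U ∈ shellIn π S (t + 2) (c + 2), ∏ u ∈ U, ω u =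
      ∑ p ∈ S, ∑ q ∈ S \ {p, π p}, ω p * ω q * ∑ U ∈ shellIn π (del2 π S p q) t c, ∏ u ∈ U, ω u := by
  have h1 := wPin_half hπ hπ' (S := S) ω (t + 1) (c + 1)
  push_cast at h1
  rw [show ((c : R) + 2) * ((c : R) + 1) * ∑ U ∈ shellIn π S (t + 2) (c + 2), ∏ u ∈ U, ω u =
      ((c : R) + 1) * (((c : R) + 1 + 1) * ∑ U ∈ shellIn π S (t + 1 + 1) (c + 1 + 1), ∏ u ∈ U, ω u) by ring,
    h1, mul_sum]
  refine sum_congr rfl fun p hp => ?_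
  rw [← mul_assoc, mul_comm ((c : R) + 1) (ω p), mul_assoc,
    wPin_half hπ hπ' (S := S \ {p, π p}) ω t c, mul_sum]
  refine sum_congr rfl fun q _ => ?_
  rw [← del2_eq_sdiff_sdiff]; ring

/-- **A full edge and an untouched edge pinned** (`free ∘ full`):
`(t+2−c)(|S|−t−2−c)·W_S(t+2,c) = Σ_{p∈S} Σ_{q∈S∖e_p} ω p·ω πp·W_{S∖e_p∖e_q}(t,c)`.
[cite: Rothvoss2017, §2 (PDF p. 6)] -/
theorem wPin_full_free {S : Finset (Fin n)} (hS : ∀ v ∈ S, π v ∈ S) (ω : Fin n → R) (t c : ℕ) :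
    ((t : R) + 2 - c) * ((S.card : R) - t - 2 - c) * ∑ U ∈ shellIn π S (t + 2) c, ∏ u ∈ U, ω u =
      ∑ p ∈ S, ∑ q ∈ S \ {p, π p}, ω p * ω (π p) * ∑ U ∈ shellIn π (del2 π S p q) t c, ∏ u ∈ U, ω u := by
  rw [show ((t : R) + 2 - c) * ((S.card : R) - t - 2 - c) * ∑ U ∈ shellIn π S (t + 2) c, ∏ u ∈ U, ω u =
      ((S.card : R) - t - 2 - c) * (((t : R) + 2 - c) * ∑ U ∈ shellIn π S (t + 2) c, ∏ u ∈ U, ω u) by ring,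
    wPin_full hπ hπ' hS ω t c, mul_sum]
  refine sum_congr rfl fun p hp => ?_
  have hcard : ((S \ {p, π p}).card : R) = (S.card : R) - 2 := by
    have := card_sdiff_pair hπ' hS hp
    rw [← this]; push_cast; ring
  have h3 := wPin_free hπ (sdiff_pair_stable hπ hS p) ω t c
  rw [hcard] at h3
  rw [← mul_assoc, mul_comm ((S.card : R) - t - 2 - c), mul_assoc,
    show (S.card : R) - t - 2 - c = (S.card : R) - 2 - t - c by ring, h3, mul_sum]
  refine sum_congr rfl fun q _ => ?_
  rw [← del2_eq_sdiff_sdiff]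

/-- **A half-matched vertex and a full edge pinned** (`full ∘ half`):
`(c+1)(t+2−c)·W_S(t+3,c+1) = Σ_{p∈S} Σ_{q∈S∖e_p} ω p·(ω q·ω πq)·W_{S∖e_p∖e_q}(t,c)`.
[cite: Rothvoss2017, §2 (PDF p. 6)] -/
theorem wPin_half_full {S : Finset (Fin n)} (hS : ∀ v ∈ S, π v ∈ S) (ω : Fin n → R) (t c : ℕ) :
    ((c : R) + 1) * ((t : R) + 2 - c) * ∑ U ∈ shellIn π S (t + 3) (c + 1), ∏ u ∈ U, ω u =
      ∑ p ∈ S, ∑ q ∈ S \ {p, π p},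
        ω p * (ω q * ω (π q)) * ∑ U ∈ shellIn π (del2 π S p q) t c, ∏ u ∈ U, ω u := by
  have h1 := wPin_half hπ hπ' (S := S) ω (t + 2) c
  rw [show shellIn π S (t + 3) (c + 1) = shellIn π S (t + 2 + 1) (c + 1) from rfl,
    show ((c : R) + 1) * ((t : R) + 2 - c) * ∑ U ∈ shellIn π S (t + 2 + 1) (c + 1), ∏ u ∈ U, ω u =
      ((t : R) + 2 - c) * (((c : R) + 1) * ∑ U ∈ shellIn π S (t + 2 + 1) (c + 1), ∏ u ∈ U, ω u) by ring,
    h1, mul_sum]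
  refine sum_congr rfl fun p hp => ?_
  rw [← mul_assoc, mul_comm ((t : R) + 2 - c) (ω p), mul_assoc,
    wPin_full hπ hπ' (sdiff_pair_stable hπ hS p) ω t c, mul_sum]
  refine sum_congr rfl fun q _ => ?_
  rw [← del2_eq_sdiff_sdiff]; ring

/-- **Two full edges pinned** (`full ∘ full`), the weighted form of `ShellLawPinning.card_shellIn_del2_full_ratio` /
`ShellLawEdgeProduct.card_mul_card_shellIn_del2_full`:
`(t+4−c)(t+2−c)·W_S(t+4,c) = Σ_{p∈S} Σ_{q∈S∖e_p} (ω p·ω πp)·(ω q·ω πq)·W_{S∖e_p∖e_q}(t,c)`.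
[cite: Rothvoss2017, §2 (PDF p. 6)] -/
theorem wPin_full_full {S : Finset (Fin n)} (hS : ∀ v ∈ S, π v ∈ S) (ω : Fin n → R) (t c : ℕ) :
    ((t : R) + 4 - c) * ((t : R) + 2 - c) * ∑ U ∈ shellIn π S (t + 4) c, ∏ u ∈ U, ω u =
      ∑ p ∈ S, ∑ q ∈ S \ {p, π p},
        ω p * ω (π p) * (ω q * ω (π q)) * ∑ U ∈ shellIn π (del2 π S p q) t c, ∏ u ∈ U, ω u := by
  have h1 := wPin_full hπ hπ' hS ω (t + 2) c
  push_cast at h1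
  rw [show shellIn π S (t + 4) c = shellIn π S (t + 2 + 2) c from rfl,
    show ((t : R) + 4 - c) * ((t : R) + 2 - c) * ∑ U ∈ shellIn π S (t + 2 + 2) c, ∏ u ∈ U, ω u =
      ((t : R) + 2 - c) * (((t : R) + 2 + 2 - c) * ∑ U ∈ shellIn π S (t + 2 + 2) c, ∏ u ∈ U, ω u) by ring,
    h1, mul_sum]
  refine sum_congr rfl fun p hp => ?_
  rw [← mul_assoc, mul_comm ((t : R) + 2 - c) (ω p * ω (π p)), mul_assoc,
    wPin_full hπ hπ' (sdiff_pair_stable hπ hS p) ω t c, mul_sum]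
  refine sum_congr rfl fun q _ => ?_
  rw [← del2_eq_sdiff_sdiff]; ring

end WeightedLevel

/-! ### §5 Iteration: `m` weighted level steps are an `m`-fold signed double sum of products of weight differences

The weighted twin of `ShellLawLevelStep.liter_prof_eq` (lit g31): with `W_S(T,c) := Σ_{U∈Shell_S(T,c)} Π_{u∈U} ω u`
and the level-step operator `(L_{A,B} P)(c) = (c+2)(c+1)·P(c+2) − (A−c)(B−A−c)·P(c)` on `R`-valued level profiles,
`2^m · (L_{t+2,|S|−4(m−1)} ∘ ⋯ ∘ L_{t+2m,|S|}) [c ↦ W_S(t+2m,c)] = (−1)^m · D^ω_m(S)(t,·)`, where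
`D^ω_0(S) = W_S(t,·)` and `D^ω_{m+1}(S) = Σ_{p∈S} Σ_{q∈S∖e_p} (ω p − ω q)(ω πp − ω πq) · D^ω_m(S∖e_p∖e_q)` — a signed sum over
sequences of `m` ordered off-edge vertex pairs of products of `m` weight-difference factors times weighted shell sums of the
`2m`-edge-deleted ground sets at cut size `t`.  For one block the factors are `±(1−X)²` (I32 iterated, `liter_prof_eq`); for two
blocks they are the mixed second differences `(1−X_i)²`, `(X₁−X₂)²`, `(1−X₁)(1−X₂)`, … (eng g21's CG2SYM). -/

section WeightedOperators

/-- The weighted level step with parameters `(A, B)` on `R`-valued level profiles: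
`(L_{A,B} P)(c) = (c+2)(c+1)·P(c+2) − (A−c)(B−A−c)·P(c)` (`ShellLawLevelStep.lstep` is the case `R = ℝ`, pointwise in `x`).
[cite: Rothvoss2017, §2 (PDF p. 6)] -/
def wlstep (A B : R) (P : ℕ → R) : ℕ → R :=
  fun c => ((c : R) + 2) * ((c : R) + 1) * P (c + 2) - (A - c) * (B - A - c) * P c

/-- The `m`-fold weighted level step `L_{A−2(m−1),B−4(m−1)} ∘ ⋯ ∘ L_{A−2,B−4} ∘ L_{A,B}` (each two-edge deletion lowers
the cut size by `2` and the ground set by `4` vertices). [cite: Rothvoss2017, §2 (PDF p. 6)] -/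
def wliter : ℕ → R → R → (ℕ → R) → (ℕ → R)
  | 0, _, _, P => P
  | m + 1, A, B, P => wliter m (A - 2) (B - 4) (wlstep A B P)

/-- No level step. [cite: Rothvoss2017, §2 (PDF p. 6)] -/
@[simp] theorem wliter_zero (A B : R) (P : ℕ → R) : wliter 0 A B P = P := rfl

/-- One more level step (innermost first). [cite: Rothvoss2017, §2 (PDF p. 6)] -/
@[simp] theorem wliter_succ (m : ℕ) (A B : R) (P : ℕ → R) :
    wliter (m + 1) A B P = wliter m (A - 2) (B - 4) (wlstep A B P) := rfl

/-- `L_{A,B}` is additive: differences. [cite: Rothvoss2017, §2 (PDF p. 6)] -/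
theorem wlstep_sub (A B : R) (P Q : ℕ → R) : wlstep A B (P - Q) = wlstep A B P - wlstep A B Q := by
  funext c; simp only [wlstep, Pi.sub_apply]; ring

/-- `L_{A,B}` is additive: sums. [cite: Rothvoss2017, §2 (PDF p. 6)] -/
theorem wlstep_add (A B : R) (P Q : ℕ → R) : wlstep A B (P + Q) = wlstep A B P + wlstep A B Q := by
  funext c; simp only [wlstep, Pi.add_apply]; ring

/-- `L_{A,B} 0 = 0`. [cite: Rothvoss2017, §2 (PDF p. 6)] -/
theorem wlstep_zero (A B : R) : wlstep A B (0 : ℕ → R) = 0 := by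
  funext c; simp [wlstep]

/-- `L_{A,B}` commutes with negation. [cite: Rothvoss2017, §2 (PDF p. 6)] -/
theorem wlstep_neg (A B : R) (P : ℕ → R) : wlstep A B (-P) = -wlstep A B P := by
  funext c; simp only [wlstep, Pi.neg_apply]; ring

/-- `L_{A,B}` is `R`-homogeneous. [cite: Rothvoss2017, §2 (PDF p. 6)] -/
theorem wlstep_smul (A B r : R) (P : ℕ → R) : wlstep A B (r • P) = r • wlstep A B P := by
  funext c; simp only [wlstep, Pi.smul_apply, smul_eq_mul]; ring

/-- `L_{A,B}` of a finite sum of profiles. [cite: Rothvoss2017, §2 (PDF p. 6)] -/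
theorem wlstep_sum {ι : Type*} (A B : R) (s : Finset ι) (P : ι → ℕ → R) :
    wlstep A B (∑ i ∈ s, P i) = ∑ i ∈ s, wlstep A B (P i) := by
  classical
  induction s using Finset.induction_on with
  | empty => simp [wlstep_zero]
  | insert a s ha ih => rw [sum_insert ha, sum_insert ha, wlstep_add, ih]

/-- The iterated level step of a difference. [cite: Rothvoss2017, §2 (PDF p. 6)] -/
theorem wliter_sub (m : ℕ) (A B : R) (P Q : ℕ → R) :
    wliter m A B (P - Q) = wliter m A B P - wliter m A B Q := by
  induction m generalizing A B P Q with
  | zero => rfl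
  | succ m ih => simp only [wliter_succ, wlstep_sub, ih]

/-- The iterated level step of a sum. [cite: Rothvoss2017, §2 (PDF p. 6)] -/
theorem wliter_add (m : ℕ) (A B : R) (P Q : ℕ → R) :
    wliter m A B (P + Q) = wliter m A B P + wliter m A B Q := by
  induction m generalizing A B P Q with
  | zero => rfl
  | succ m ih => simp only [wliter_succ, wlstep_add, ih]

/-- The iterated level step of the zero profile. [cite: Rothvoss2017, §2 (PDF p. 6)] -/
theorem wliter_zero_profile (m : ℕ) (A B : R) : wliter m A B (0 : ℕ → R) = 0 := by
  induction m generalizing A B with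
  | zero => rfl
  | succ m ih => simp only [wliter_succ, wlstep_zero, ih]

/-- The iterated level step commutes with negation. [cite: Rothvoss2017, §2 (PDF p. 6)] -/
theorem wliter_neg (m : ℕ) (A B : R) (P : ℕ → R) : wliter m A B (-P) = -wliter m A B P := by
  induction m generalizing A B P with
  | zero => rfl
  | succ m ih => simp only [wliter_succ, wlstep_neg, ih]

/-- The iterated level step is `R`-homogeneous. [cite: Rothvoss2017, §2 (PDF p. 6)] -/
theorem wliter_smul (m : ℕ) (A B r : R) (P : ℕ → R) : wliter m A B (r • P) = r • wliter m A B P := by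
  induction m generalizing A B P with
  | zero => rfl
  | succ m ih => simp only [wliter_succ, wlstep_smul, ih]

/-- The iterated level step of a finite sum of profiles. [cite: Rothvoss2017, §2 (PDF p. 6)] -/
theorem wliter_sum {ι : Type*} (m : ℕ) (A B : R) (s : Finset ι) (P : ι → ℕ → R) :
    wliter m A B (∑ i ∈ s, P i) = ∑ i ∈ s, wliter m A B (P i) := by
  classical
  induction s using Finset.induction_on with
  | empty => simp [wliter_zero_profile]
  | insert a s ha ih => rw [sum_insert ha, sum_insert ha, wliter_add, ih]

end WeightedOperators

section WeightedIterate

variable (π)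

/-- The weighted shell-sum profile of `S` at cut size `T`: `c ↦ W_S(T,c) = Σ_{U∈Shell_S(T,c)} Π_{u∈U} ω u`.
[cite: Rothvoss2017, §2 (PDF p. 6)] -/
def wsum (ω : Fin n → R) (S : Finset (Fin n)) (T : ℕ) : ℕ → R :=
  fun c => ∑ U ∈ shellIn π S T c, ∏ u ∈ U, ω u

/-- The `m`-fold weighted deletion profile at cut size `t`: `D^ω_0(S) = W_S(t,·)`,
`D^ω_{m+1}(S) = Σ_{p∈S} Σ_{q∈S∖e_p} (ω p − ω q)(ω πp − ω πq) · D^ω_m(S∖e_p∖e_q)`.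
[cite: Rothvoss2017, §2 (PDF p. 6)] -/
def wdelIter (ω : Fin n → R) (t : ℕ) : ℕ → Finset (Fin n) → (ℕ → R)
  | 0, S => wsum π ω S t
  | m + 1, S => ∑ p ∈ S, ∑ q ∈ S \ {p, π p}, ((ω p - ω q) * (ω (π p) - ω (π q))) • wdelIter ω t m (del2 π S p q)

variable {π}

/-- `W_S(T,c)` unfolded. [cite: Rothvoss2017, §2 (PDF p. 6)] -/
@[simp] theorem wsum_apply (ω : Fin n → R) (S : Finset (Fin n)) (T c : ℕ) :
    wsum π ω S T c = ∑ U ∈ shellIn π S T c, ∏ u ∈ U, ω u := rfl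

/-- `D^ω_0(S)` is the weighted shell-sum profile itself. [cite: Rothvoss2017, §2 (PDF p. 6)] -/
@[simp] theorem wdelIter_zero (ω : Fin n → R) (t : ℕ) (S : Finset (Fin n)) :
    wdelIter π ω t 0 S = wsum π ω S t := rfl

/-- `D^ω_{m+1}(S)` by one more two-edge deletion (outermost first). [cite: Rothvoss2017, §2 (PDF p. 6)] -/
@[simp] theorem wdelIter_succ (ω : Fin n → R) (t m : ℕ) (S : Finset (Fin n)) :
    wdelIter π ω t (m + 1) S =
      ∑ p ∈ S, ∑ q ∈ S \ {p, π p}, ((ω p - ω q) * (ω (π p) - ω (π q))) • wdelIter π ω t m (del2 π S p q) := rfl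

variable (hπ : ∀ v, π (π v) = v) (hπ' : ∀ v, π v ≠ v)
include hπ hπ'

/-- `|S ∖ e_p ∖ e_q| = |S| − 4` in `R`, for `p ∈ S`, `q ∈ S ∖ e_p`. [cite: GodsilMeagher2015, §15.2] -/
theorem card_del2_cast {S : Finset (Fin n)} (hS : ∀ v ∈ S, π v ∈ S) {p q : Fin n} (hp : p ∈ S)
    (hq : q ∈ S \ {p, π p}) : ((del2 π S p q).card : R) = (S.card : R) - 4 := by
  rw [mem_sdiff, mem_insert, mem_singleton, not_or] at hq
  have h := card_del2_add_four hπ hπ' hS hp hq.1 hq.2.1 hq.2.2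
  rw [← h]; push_cast; ring

/-- The one-step identity in profile form: `2·L_{t+2,|S|} W_S(t+2,·) = −D^ω_1(S)(t,·)`.
[cite: Rothvoss2017, §2 (PDF p. 6)] -/
theorem wlstep_wsum {S : Finset (Fin n)} (hS : ∀ v ∈ S, π v ∈ S) (ω : Fin n → R) (t : ℕ) :
    (2 : R) • wlstep ((t : R) + 2) (S.card : R) (wsum π ω S (t + 2)) = -wdelIter π ω t 1 S := by
  funext c
  have h := wLevelStep_two_mul hπ hπ' hS ω t c
  simp only [wdelIter_succ, wdelIter_zero, Pi.smul_apply, Pi.neg_apply, Finset.sum_apply, smul_eq_mul,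
    wlstep, wsum_apply]
  rw [show ((t : R) + 2 - c) * ((S.card : R) - ((t : R) + 2) - c) =
      ((t : R) + 2 - c) * ((S.card : R) - t - 2 - c) by ring, h]

/-- **`m` WEIGHTED LEVEL STEPS** (the iterated identity): for every `m`, every `π`-stable ground set `S`, all
vertex weights `ω` and all `t`,
`2^m · (L_{t+2,|S|−4(m−1)} ∘ ⋯ ∘ L_{t+2m,|S|}) [c ↦ W_S(t+2m,c)] = (−1)^m · D^ω_m(S)(t,·)`:
the `m`-th weighted level difference of the weighted shell sums at cut size `t + 2m` is a signed sum, over sequences of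
`m` ordered off-edge vertex pairs, of the products of the `m` weight-difference factors `(ω p − ω q)(ω πp − ω πq)` times
the weighted shell sums at cut size `t` of the sub-matchings with `2m` edges deleted.  (One block, `ω = X^{[·∈H]}`:
`ShellLawLevelStep.liter_prof_eq` after coefficient extraction; two blocks: the mixed second differences of CG2SYM.)
[cite: Rothvoss2017, §2 (PDF p. 6)] -/
theorem wliter_wsum_eq (ω : Fin n → R) (t m : ℕ) :
    ∀ {S : Finset (Fin n)}, (∀ v ∈ S, π v ∈ S) →
      (2 : R) ^ m • wliter m ((t : R) + 2 * m) (S.card : R) (wsum π ω S (t + 2 * m)) =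
        ((-1 : R) ^ m) • wdelIter π ω t m S := by
  induction m with
  | zero => intro S _; simp
  | succ m ih =>
    intro S hS
    rw [wliter_succ]
    have e1 : ((t : R) + 2 * (m + 1 : ℕ)) = ((t + 2 * m : ℕ) : R) + 2 := by push_cast; ring
    have e2 : t + 2 * (m + 1) = (t + 2 * m) + 2 := by ring
    have e3 : ((t + 2 * m : ℕ) : R) + 2 - 2 = ((t : R) + 2 * m) := by push_cast; ring
    -- 2^{m+1} • wliter m … (wlstep …) = 2^m • wliter m … (2 • wlstep …) = −2^m • wliter m … (D^ω_1 S)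
    rw [e1, e2, pow_succ, mul_smul, ← wliter_smul, wlstep_wsum hπ hπ' hS ω (t + 2 * m), e3, wliter_neg,
      smul_neg]
    -- push the iterated step through the double sum and apply the induction hypothesis on each deleted set
    have hinner : (2 : R) ^ m • wliter m ((t : R) + 2 * m) ((S.card : R) - 4) (wdelIter π ω (t + 2 * m) 1 S) =
        ∑ p ∈ S, ∑ q ∈ S \ {p, π p}, ((ω p - ω q) * (ω (π p) - ω (π q))) •
          (((-1 : R) ^ m) • wdelIter π ω t m (del2 π S p q)) := by
      rw [wdelIter_succ, wliter_sum, Finset.smul_sum]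
      refine sum_congr rfl fun p hp => ?_
      rw [wliter_sum, Finset.smul_sum]
      refine sum_congr rfl fun q hq => ?_
      rw [wliter_smul, smul_comm ((2 : R) ^ m), wdelIter_zero, ← card_del2_cast hπ hπ' hS hp hq,
        ih (del2_stable hπ hS p q)]
    -- collect the signs
    rw [hinner, wdelIter_succ ω t m S, pow_succ, mul_smul, neg_one_smul, smul_neg, Finset.smul_sum]
    congr 1
    refine sum_congr rfl fun p _ => ?_
    rw [Finset.smul_sum]
    refine sum_congr rfl fun q _ => ?_
    exact smul_comm _ _ _

end WeightedIterate

end ShellStep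

end Literature.Combinatorics.Optimization

end
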